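import Summits.QuantumFields.YangMills.Theorems.FluctuationComparisonRegPrIntLS2BetaClosePairL2Tower
import HarnessLib

/-!
# CLOSE-PAIR IN `ℓ²` AT EVERY DEPTH, VOLUME-UNIFORM, UNDER THE ORGANS' PREFIX — two good histories over the same datum are `ℓ²`-close modulo a residual transformation with
# the sum of their actions on the right and a constant `C(L, K − J)` chosen before the family, the coupling and the run
# (crux `FluctuationComparisonRegPrIntL`, stmt-QuantumFields-20520; registry v11.4 `Cruxes/FluctuationComparisonRegPrIntL/Lines/semiclassical_s2beta.lean` 3732b7df FROZEN, untouched)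

Cell `ym3-torus` (YM ladder rung R3 = continuum `SU(2)` Yang–Mills on the three-torus — a RUNG: NOT d = 4, NOT infinite volume, NOT a mass gap, NOT Clay).
Width seat `ym3-torus-px12` (gen 22); `--kind proof --supports stmt-QuantumFields-20520 --as helper`, count-neutral, DEFINITION-FREE (0 `def`, 0 `instance`,
0 `notation`, 0 `sorry`, default heartbeats).

WHY.  ✓`…S2BetaClosePairL2Tower.pair_tower` is stated for a fixed threshold under the guards and a smallness clause on every descended field.  This file reads it under the
prefix of px8 g18's ✓`closePair_holds` (CLOSE-PAIR∘): good histories `U, U′ ∈ fibre_{J,K}(V) ∩ histGood(θBal b₀)`, `γ ≤ γ₁(L, b₀, p₀)`, conclusion a RESIDUAL `w` — with the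
`δ`-sup closeness of CLOSE-PAIR∘ replaced by the `ℓ²` bound `Σ_ℓ dist1(U ℓ·((w • U′) ℓ)⁻¹)² ≤ C(L, K − J)·(A(U) + A(U′))` (lit ✓`exists_gamma_forall_θBal_le` puts every `θBal` of
the history under the guard threshold `θ*(L)`; ✓`plaqSmall_fieldShift` reads the history as the descended fields).

WHAT.
* ★★★ `closePairL2_allDepths_volumeUniform` — `∀ L b₀ p₀, ∃ γ₁ > 0, ∀ m, ∃ C ≥ 0, ∀ F (F.L = L), ∀ 0 < γ ≤ γ₁, ∀ J ≤ K with K − J = m, ∀ V, ∀ U U′ ∈ fibre_{J,K}(V) ∩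
  histGood(θBal b₀): ∃ w residual, Σ_ℓ dist1(U ℓ·((w • U′) ℓ)⁻¹)² ≤ C·(wilsonAction4 U + wilsonAction4 U′)` — `C` depends on `L` and the DEPTH only.

HONEST: `C(L, m)` grows geometrically in the depth `m`; lattice kinematics + Cauchy–Schwarz; nothing of Bałaban's analysis; CLOSE-PAIR∘ (sup) is px8's ✓`closePair_holds` and is NOT
re-proved here; TUBE-REG∘, GAP♯∘, EXW∘, S2β, crux 20520 NOT proved; no registered stub is closed; rung R3 = SU(2) YM₃ on T³ — NOT d = 4, NOT infinite volume, NOT a mass gap, NOT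
Clay; the Yang–Mills mass gap is NOT proved.  Sorry-free, axioms standard.

References: T. Bałaban, CMP **99** (1985) 75–102 [Balaban1985RegularSpaces] (Lemma 1 (1.24)–(1.26) pp.79–80); CMP **102** (1985) 255–275 [Balaban1985UV3] ((7) p.257, (12)–(13)
p.259); CMP **109** (1987) 249–301 [Balaban1987RG1] ((0.4), (0.11) p.253).
-/

set_option autoImplicit false

noncomputable section

namespace Summit.QuantumFields.YangMills.Theorems.FluctuationComparisonRegPrIntLS2BetaClosePairL2AllDepths

open Finset
open Literature.MathematicalPhysics.QuantumFieldTheory.Balaban1983to89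
open T4Continuum BlockAveraging AveragingRT ExpMeanLog
open T3ContinuumYM3Torus
open T3UnitLawDensityEML (ℰp)
open T3UnitScaleTilt T3TiltDescent T3LevelShift
open T3ConstrainedMinimiser (fibre)
open T3PrintedRegularMinimiser
open T3PrintedMinimiserExistence (plaqSmall_of_le)
open T3CruxEstimates (plaqSmall_fieldShift)
open T3Thresholds (exists_gamma_forall_θBal_le)
open Summit.QuantumFields.YangMills.Theorems.FluctuationComparisonRegPrIntLS2BetaClosePairL2Tower (pair_tower)

open scoped Matrix.Norms.L2Operator

/-- ★★★ **CLOSE-PAIR IN `ℓ²`, EVERY DEPTH, VOLUME-UNIFORM** (CLOSE-PAIR∘'s prefix; the constant depends on `L` and the depth `K − J` only).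
[cite: Balaban1985RegularSpaces, Lemma 1 (1.24)-(1.26) pp.79-80; Balaban1985UV3, (7) p.257, (12)-(13) p.259] -/
theorem closePairL2_allDepths_volumeUniform (L : ℕ) (b₀ p₀ : ℝ) (hb : 0 < b₀) (hp : 0 < p₀) :
    ∃ γ₁ : ℝ, 0 < γ₁ ∧ ∀ m : ℕ, ∃ C : ℝ, 0 ≤ C ∧ ∀ (F : T3Family) (γ : ℝ), F.L = L → 0 < γ → γ ≤ γ₁ →
      ∀ (J K : ℕ) (hJK : J ≤ K), K - J = m → ∀ (V : GaugeField (F.P J) 0 (Matrix.specialUnitaryGroup (Fin 2) ℂ)),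
        ∀ U ∈ fibre F ℰp J K hJK V, U ∈ histGood F ℰp (θBal F.L γ b₀ p₀) K J →
        ∀ U' ∈ fibre F ℰp J K hJK V, U' ∈ histGood F ℰp (θBal F.L γ b₀ p₀) K J →
          ∃ w : Site (F.P K) 0 → (Matrix.specialUnitaryGroup (Fin 2) ℂ),
            (∀ U'' : GaugeField (F.P K) 0 (Matrix.specialUnitaryGroup (Fin 2) ℂ),
              descendTo F ℰp J K hJK (GaugeField.gaugeAct w U'') = descendTo F ℰp J K hJK U'') ∧
            ∑ ℓ : PBond (F.P K) 0, dist1 (U ℓ * ((GaugeField.gaugeAct w U') ℓ)⁻¹) ^ 2 ≤ C * (wilsonAction4 U + wilsonAction4 U') := by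
  classical
  rcases Nat.eq_zero_or_pos L with hL0 | hLpos
  · subst hL0
    exact ⟨1, one_pos, fun m => ⟨0, le_rfl, fun F γ hFL => absurd hFL (by have := F.hL.2; omega)⟩⟩
  have ht0 : (0 : ℝ) < (deltaSU (Fin 2) / ((((3 + 2) * L : ℕ) : ℝ) ^ 2 / 4)) := by
    have hδ := ExpMeanLog.deltaSU_pos (n := Fin 2)
    have : (0 : ℝ) < ((((3 + 2) * L : ℕ) : ℝ)) := by exact_mod_cast Nat.mul_pos (by norm_num) hLpos
    positivity
  set θs : ℝ := (deltaSU (Fin 2) / ((((3 + 2) * L : ℕ) : ℝ) ^ 2 / 4)) / (Real.sqrt (2 * ((3 ^ 2 * (2 * (2 * 3 * L + L) + 1) ^ 3 : ℕ) : ℝ)) + Real.sqrt ((3 ^ 2 * (2 * (3 * L) + 1) ^ 3 * (2 * 3 + 1) ^ 3 : ℕ) : ℝ) + 1) with hθs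
  have hsq1 := Real.sqrt_nonneg (2 * ((3 ^ 2 * (2 * (2 * 3 * L + L) + 1) ^ 3 : ℕ) : ℝ))
  have hsq2 := Real.sqrt_nonneg ((3 ^ 2 * (2 * (3 * L) + 1) ^ 3 * (2 * 3 + 1) ^ 3 : ℕ) : ℝ)
  have hden : (0 : ℝ) < Real.sqrt (2 * ((3 ^ 2 * (2 * (2 * 3 * L + L) + 1) ^ 3 : ℕ) : ℝ)) + Real.sqrt ((3 ^ 2 * (2 * (3 * L) + 1) ^ 3 * (2 * 3 + 1) ^ 3 : ℕ) : ℝ) + 1 := by positivity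
  have hθs0 : 0 < θs := div_pos ht0 hden
  have hg1 : Real.sqrt (2 * ((3 ^ 2 * (2 * (2 * 3 * L + L) + 1) ^ 3 : ℕ) : ℝ)) * θs < (deltaSU (Fin 2) / ((((3 + 2) * L : ℕ) : ℝ) ^ 2 / 4)) := by
    rw [hθs, mul_div_assoc', div_lt_iff₀ hden]
    have hm1 := mul_nonneg ht0.le hsq2
    nlinarith
  have hg2 : Real.sqrt ((3 ^ 2 * (2 * (3 * L) + 1) ^ 3 * (2 * 3 + 1) ^ 3 : ℕ) : ℝ) * θs < (deltaSU (Fin 2) / ((((3 + 2) * L : ℕ) : ℝ) ^ 2 / 4)) := by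
    rw [hθs, mul_div_assoc', div_lt_iff₀ hden]
    have hm1 := mul_nonneg ht0.le hsq1
    nlinarith
  obtain ⟨γ₁, hγ₁, hγ₁1, hθ⟩ := exists_gamma_forall_θBal_le (b₀ := b₀) (p₀ := p₀) hb hp hθs0
  refine ⟨γ₁, hγ₁, fun m => ⟨8 * ((2 * (((3 : ℕ) : ℝ) * (L : ℝ)) ^ 2 + 2 * (6 * ((((3 + 2) * L : ℕ) : ℝ) ^ 2 / 4)) + ((3 * ((L - 1) / 2) : ℕ) : ℝ) * (4 * (((3 : ℕ) : ℝ) * (L : ℝ)) ^ 2 + 2)) ^ 2 * ((3 * (2 * (2 * 3 * L + L + 3 * L) + 1) ^ 3 : ℕ) : ℝ)) * (2 * ((3 * (2 * (3 * L) + 1) ^ 3 : ℕ) : ℝ) * (((2 : ℕ) : ℝ) * (((L : ℝ) ^ 2 + 6 * (((3 + 2) * L : ℕ) : ℝ) ^ 2) ^ 2 * ((3 ^ 2 * (2 * 3 + 1) ^ 3 : ℕ) : ℝ))) + 1) ^ m, by positivity, ?_⟩⟩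
  intro F γ hFL hγ hγle J K hJK hKJ V U hU hUg U' hU' hU'g
  have hL1 : 1 ≤ F.L := F.hL.2.le
  have hsmall : ∀ X : GaugeField (F.P K) 0 (Matrix.specialUnitaryGroup (Fin 2) ℂ), X ∈ histGood F ℰp (θBal F.L γ b₀ p₀) K J →
      ∀ (i : ℕ) (hJi : J ≤ i) (hiK : i ≤ K), PlaqSmall θs (descendTo F ℰp i K hiK X) := by
    intro X hXg i hJi hiK
    have h := hXg (K - i) (by omega)
    have hle : θBal F.L γ b₀ p₀ (K - (K - i)) ≤ θs := hθ F.L hL1 γ hγ hγle _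
    show PlaqSmall θs (fieldShift _ (Averaging.iter (fun i => BlockAveraging.blockAvg (P := F.P K) (j := i) ℰp) (K - i) X))
    rw [plaqSmall_fieldShift]
    exact plaqSmall_of_le hle h
  have hθ1 : ∀ K' : ℕ, Real.sqrt (2 * ((((F.P K').d ^ 2 * (2 * (2 * (F.P K').d * (F.P K').L + (F.P K').L) + 1) ^ (F.P K').d : ℕ) : ℝ))) * θs <
      deltaSU (Fin 2) / (((((F.P K').d + 2) * (F.P K').L : ℕ) : ℝ) ^ 2 / 4) := by
    intro K'
    have hd : (F.P K').d = 3 := T3Family.P_d F K'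
    have hPL : (F.P K').L = L := by rw [← hFL]; rfl
    rw [hd, hPL]
    exact hg1
  have hθ2 : ∀ K' : ℕ, Real.sqrt ((((F.P K').d ^ 2 * (2 * ((F.P K').d * (F.P K').L) + 1) ^ (F.P K').d * (2 * (F.P K').d + 1) ^ (F.P K').d : ℕ) : ℝ)) * θs <
      deltaSU (Fin 2) / (((((F.P K').d + 2) * (F.P K').L : ℕ) : ℝ) ^ 2 / 4) := by
    intro K'
    have hd : (F.P K').d = 3 := T3Family.P_d F K'
    have hPL : (F.P K').L = L := by rw [← hFL]; rfl
    rw [hd, hPL]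
    exact hg2
  obtain ⟨w, hres, hsum⟩ := pair_tower F hθs0.le hθ1 hθ2 m K J hJK hKJ V U U' hU hU' (hsmall U hUg) (hsmall U' hU'g)
  rw [hFL] at hsum
  exact ⟨w, hres, hsum⟩

end Summit.QuantumFields.YangMills.Theorems.FluctuationComparisonRegPrIntLS2BetaClosePairL2AllDepths

end
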